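import Literature.Topology.FourManifolds.FlowsProofs
import Literature.Topology.FourManifolds.GradientLike
import Literature.Topology.FourManifolds.RegularInterval
import Literature.Topology.FourManifolds.TrisectionsSectorAtlas
import Literature.Topology.FourManifolds.TrisectionsNormalCoordinates
import Mathlib.Geometry.Manifold.PartitionOfUnity
import Mathlib.Analysis.Calculus.Deriv.MeanValue
import HarnessLib

/-!
# The product structure along the central surface of a Gay–Kirby trisection

Topic `Literature/Topology/FourManifolds`; infrastructure for the fact seat
`provefact-Literature.Topology.FourManifolds.exists-14560f9fc8` (named fact (c′)
`Literature.Topology.FourManifolds.exists_stabilized_gkTrisection`), continuing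
`TrisectionsNormalCoordinates.lean`.  Everything in this file is **proved**; no definitions,
no named facts.

Given the global normal coordinates `u, v` of `IsGKTrisection.exists_normalCoordinates`
(all three sectors are linear sectors of the `(u, v)`-plane near the central surface `F`, and
`(u, v)` is completed to a chart of the maximal atlas at every point of `F`), this file builds
the **product structure** `F × ℝ²` near `F` and the **corner-slice charts**
(`Literature.Topology.FourManifolds.CornerSliceChart` of `TrisectionsSectorAtlas.lean`) of a
sector at the points of `F`, with *common* normal coordinates `u, v` and a *common* tangential
retraction `ρ` — exactly the input format of the straightened sector atlas
`Literature.Topology.FourManifolds.CornerSliceAtlas`.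

* `clock_two`, `clock_two_neg` — the two-dimensional clock along a curve (Milnor's "`t ↦ f(φ_t q)`
  has derivative `1` as long as the curve stays in the band", for two functions at once: the
  set of good times is closed, and open to the right by the mean value theorem).
* `exists_local_section_mlineDeriv_eq`, `exists_section_mlineDeriv_eq` — smooth vector fields
  with `du(ξ) = a`, `dv(ξ) = b` along a closed set carrying `(u, v)`-adapted charts (local
  fields by Cramer's rule on two fields through `dΞ⁻¹e₀`, `dΞ⁻¹e₁`; globalisation by Mathlib's
  `exists_contMDiffSection_forall_mem_convex_of_local`).
* `flow_mem_and_apply_eq` — the flow of such a field moves `(u, v)` linearly while the predicted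
  values stay in a disc.
* **`exists_cornerSliceChart_of_normalCoordinates`** — the retraction
  `ρ y = φ²_{-v y} φ¹_{-u y} y` onto the corner locus `K = {u = v = 0}` and, at every point of
  `K`, a corner-slice chart `y ↦ (u y, v y, Ξ(ρ y)₂, Ξ(ρ y)₃)` whose inverse is the
  two-parameter flow-out `(a, b, z) ↦ φ¹_a φ²_b z` of the stratum (the group law of the flows
  and the clock; no derivative needs to be computed).
* **`IsGKTrisection.exists_cornerSliceCharts`** — for a Gay–Kirby trisection, a sector `S i`
  and a second sector `S j`: normal coordinates, the retraction and corner-slice charts of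
  `S i` along the whole central surface.

## References

* J. Milnor, *Morse theory*, Ann. of Math. Studies 51 (1963), proof of Thm. 3.1 (the clock
  along a normalised gradient flow). [Milnor1963]
* J. Milnor, *Lectures on the h-cobordism theorem* (1965), proof of Lemma 3.2 (vector fields
  by partitions of unity) and of Thm. 3.4 (the drop onto a level). [MilnorHCobordism1965]
* A. Douady, *Variétés à bord anguleux et voisinages tubulaires*, Séminaire H. Cartan 14
  (1961/62), exp. 1, §4 (product neighbourhoods of the corner strata). [Douady1961]
* D. Gay, R. Kirby, *Trisecting 4-manifolds*, Geom. Topol. 20 (2016) 3097–3132, Def. 1 and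
  Def. 8. [GayKirby2016]
-/

open scoped Manifold ContDiff Topology
open Set Function Filter Bundle

noncomputable section

namespace Literature.Topology.FourManifolds

universe u

section Clock

/-- **Two-dimensional clock along a curve.**  Let `γ` be a continuous curve in `X`, `u, v`
two continuous functions whose compositions with `γ` are differentiable with derivatives `g'`,
`h'`, `K ⊆ X` closed and `O ⊆ K` open, such that every point of `K` with `u² + v² < η` lies in
`O`, and such that `(u ∘ γ)' = a`, `(v ∘ γ)' = b` (two constants) at times when `γ ∈ O`.  If
`γ t₀ ∈ O` and the *predicted* values stay in the disc,
`(u (γ t₀) + a s)² + (v (γ t₀) + b s)² < η` for `s ∈ [0, T]`, then on `[0, T]` the curve stays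
in `O` with `u (γ (t₀ + s)) = u (γ t₀) + a s` and `v (γ (t₀ + s)) = v (γ t₀) + b s` (the set
of good times is closed, and open to the right by the mean value theorem; Milnor's "`t ↦ f(φ_t(q))`
has derivative `1` as long as `φ_t(q)` stays in the band"). [folklore] -/
theorem clock_two {X : Type*} [TopologicalSpace X] {γ : ℝ → X} (hγ : Continuous γ)
    {u v : X → ℝ} (hu : Continuous u) (hv : Continuous v) {g' h' : ℝ → ℝ}
    (hg : ∀ t, HasDerivAt (u ∘ γ) (g' t) t) (hh : ∀ t, HasDerivAt (v ∘ γ) (h' t) t)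
    {K O : Set X} (hK : IsClosed K) (hO : IsOpen O) (hOK : O ⊆ K) {η a b : ℝ}
    (hKO : ∀ y ∈ K, u y ^ 2 + v y ^ 2 < η → y ∈ O)
    (hga : ∀ t, γ t ∈ O → g' t = a) (hhb : ∀ t, γ t ∈ O → h' t = b)
    {t₀ T : ℝ} (h₀ : γ t₀ ∈ O)
    (hpred : ∀ s ∈ Icc 0 T, (u (γ t₀) + a * s) ^ 2 + (v (γ t₀) + b * s) ^ 2 < η) :
    ∀ s ∈ Icc 0 T, γ (t₀ + s) ∈ O ∧ u (γ (t₀ + s)) = u (γ t₀) + a * s ∧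
      v (γ (t₀ + s)) = v (γ t₀) + b * s := by
  set S : Set ℝ := {s | γ (t₀ + s) ∈ K ∧ u (γ (t₀ + s)) = u (γ t₀) + a * s ∧
    v (γ (t₀ + s)) = v (γ t₀) + b * s} with hS
  have hγs : Continuous fun s => γ (t₀ + s) := hγ.comp (continuous_const.add continuous_id)
  have hSc : IsClosed S :=
    (hK.preimage hγs).inter ((isClosed_eq (hu.comp hγs)
      (continuous_const.add (continuous_const.mul continuous_id))).inter
      (isClosed_eq (hv.comp hγs) (continuous_const.add (continuous_const.mul continuous_id))))
  -- good times in `[0, T]` put the curve in `O`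
  have hgoodO : ∀ s ∈ Icc 0 T, s ∈ S → γ (t₀ + s) ∈ O := by
    rintro s hs ⟨hsK, hsu, hsv⟩
    exact hKO _ hsK (by rw [hsu, hsv]; exact hpred s hs)
  have key : Icc 0 T ⊆ S := by
    apply (hSc.inter isClosed_Icc).Icc_subset_of_forall_mem_nhdsWithin
    · refine ⟨?_, ?_, ?_⟩
      · rw [add_zero]; exact hOK h₀
      · rw [add_zero, mul_zero, add_zero]
      · rw [add_zero, mul_zero, add_zero]
    · rintro s ⟨hs, hs0, hsT⟩
      have hsO : γ (t₀ + s) ∈ O := hgoodO s ⟨hs0, hsT.le⟩ hs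
      -- nearby times keep the curve in `O`
      have hnear : ∀ᶠ r in 𝓝 s, γ (t₀ + r) ∈ O :=
        hγs.continuousAt.eventually (hO.mem_nhds hsO)
      obtain ⟨ε, hε, hball⟩ := Metric.eventually_nhds_iff_ball.1 hnear
      have hmem : Ioo s (s + ε / 2) ⊆ S := fun r hr => by
        have hsr : t₀ + s < t₀ + r := by linarith [hr.1]
        have hinO : ∀ c ∈ Icc (t₀ + s) (t₀ + r), γ c ∈ O := by
          intro c hc
          have : c - t₀ ∈ Metric.ball s ε := by
            rw [Metric.mem_ball, Real.dist_eq, abs_lt]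
            constructor <;> linarith [hc.1, hc.2, hr.2]
          have := hball _ this
          rwa [add_sub_cancel] at this
        -- mean value theorem for `u ∘ γ` and `v ∘ γ` on `[t₀ + s, t₀ + r]`
        have hcu : ContinuousOn (u ∘ γ) (Icc (t₀ + s) (t₀ + r)) := (hu.comp hγ).continuousOn
        have hcv : ContinuousOn (v ∘ γ) (Icc (t₀ + s) (t₀ + r)) := (hv.comp hγ).continuousOn
        obtain ⟨c, hc, hslope⟩ := exists_hasDerivAt_eq_slope (u ∘ γ) g' hsr hcu
          (fun c _ => hg c)
        obtain ⟨d, hd, hslope'⟩ := exists_hasDerivAt_eq_slope (v ∘ γ) h' hsr hcv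
          (fun d _ => hh d)
        have hca : g' c = a := hga c (hinO c ⟨hc.1.le, hc.2.le⟩)
        have hdb : h' d = b := hhb d (hinO d ⟨hd.1.le, hd.2.le⟩)
        have hne : (t₀ + r) - (t₀ + s) ≠ 0 := by linarith
        rw [hca, eq_div_iff hne] at hslope
        rw [hdb, eq_div_iff hne] at hslope'
        simp only [comp_apply] at hslope hslope'
        refine ⟨hOK (hinO _ ⟨hsr.le, le_rfl⟩), ?_, ?_⟩
        · rw [hs.2.1] at hslope; linear_combination -hslope
        · rw [hs.2.2] at hslope'; linear_combination -hslope'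
      have hIoo : Ioo s (s + ε / 2) ∈ 𝓝[>] s := Ioo_mem_nhdsGT (by linarith)
      exact mem_of_superset hIoo hmem
  intro s hs
  have hsS := key hs
  exact ⟨hgoodO s hs hsS, hsS.2.1, hsS.2.2⟩

/-- **The clock for negative times**: the same conclusion on `[-T, 0]`, by time reversal.
[folklore] -/
theorem clock_two_neg {X : Type*} [TopologicalSpace X] {γ : ℝ → X} (hγ : Continuous γ)
    {u v : X → ℝ} (hu : Continuous u) (hv : Continuous v) {g' h' : ℝ → ℝ}
    (hg : ∀ t, HasDerivAt (u ∘ γ) (g' t) t) (hh : ∀ t, HasDerivAt (v ∘ γ) (h' t) t)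
    {K O : Set X} (hK : IsClosed K) (hO : IsOpen O) (hOK : O ⊆ K) {η a b : ℝ}
    (hKO : ∀ y ∈ K, u y ^ 2 + v y ^ 2 < η → y ∈ O)
    (hga : ∀ t, γ t ∈ O → g' t = a) (hhb : ∀ t, γ t ∈ O → h' t = b)
    {t₀ T : ℝ} (h₀ : γ t₀ ∈ O)
    (hpred : ∀ s ∈ Icc (-T) 0, (u (γ t₀) + a * s) ^ 2 + (v (γ t₀) + b * s) ^ 2 < η) :
    ∀ s ∈ Icc (-T) 0, γ (t₀ + s) ∈ O ∧ u (γ (t₀ + s)) = u (γ t₀) + a * s ∧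
      v (γ (t₀ + s)) = v (γ t₀) + b * s := by
  -- the reversed curve `t ↦ γ (-t)` has speeds `(-a, -b)`
  set δ : ℝ → X := fun t => γ (-t) with hδ
  have hδc : Continuous δ := hγ.comp continuous_neg
  have hgδ : ∀ t, HasDerivAt (u ∘ δ) (-g' (-t)) t := fun t => by
    have := (hg (-t)).scomp t (hasDerivAt_neg t)
    simpa [hδ, comp_def] using this
  have hhδ : ∀ t, HasDerivAt (v ∘ δ) (-h' (-t)) t := fun t => by
    have := (hh (-t)).scomp t (hasDerivAt_neg t)
    simpa [hδ, comp_def] using this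
  have key := clock_two hδc hu hv hgδ hhδ hK hO hOK (η := η) (a := -a) (b := -b) hKO
    (fun t ht => by show -g' (-t) = -a; rw [hga (-t) ht])
    (fun t ht => by show -h' (-t) = -b; rw [hhb (-t) ht]) (t₀ := -t₀) (T := T)
    (by show γ (- -t₀) ∈ O; rw [neg_neg]; exact h₀) (fun s hs => by
      have := hpred (-s) ⟨by linarith [hs.2], by linarith [hs.1]⟩
      have e1 : γ (- -t₀) = γ t₀ := by rw [neg_neg]
      simp only [hδ, e1]
      convert this using 2 <;> ring)
  intro s hs
  obtain ⟨h1, h2, h3⟩ := key (-s) ⟨by linarith [hs.2], by linarith [hs.1]⟩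
  have e : δ (-t₀ + -s) = γ (t₀ + s) := by simp only [hδ]; congr 1; ring
  have e1 : δ (-t₀) = γ t₀ := by simp only [hδ, neg_neg]
  rw [e, e1] at h2 h3
  rw [e] at h1
  exact ⟨h1, by rw [h2]; ring, by rw [h3]; ring⟩

end Clock

section Quad

/-- A convex quadratic on a segment is bounded by its values at the endpoints:
`(p + a s')² + (q + b s')² ≤ max (p² + q²) ((p + a s)² + (q + b s)²)` for `0 ≤ s' ≤ s`.
[folklore] -/
theorem quad_le_max (p q a b s s' : ℝ) (h0 : 0 ≤ s') (h1 : s' ≤ s) :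
    (p + a * s') ^ 2 + (q + b * s') ^ 2 ≤
      max (p ^ 2 + q ^ 2) ((p + a * s) ^ 2 + (q + b * s) ^ 2) := by
  by_cases hc : (p + a * s') ^ 2 + (q + b * s') ^ 2 ≤ p ^ 2 + q ^ 2
  · exact le_max_of_le_left hc
  · push Not at hc
    apply le_max_of_le_right
    -- `f t - f 0 = t (2c + d t)` with `c = pa + qb`, `d = a² + b²`
    have key : ∀ t : ℝ, (p + a * t) ^ 2 + (q + b * t) ^ 2 - (p ^ 2 + q ^ 2) =
        t * (2 * (p * a + q * b) + (a ^ 2 + b ^ 2) * t) := fun t => by ring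
    have hpos : 0 < s' * (2 * (p * a + q * b) + (a ^ 2 + b ^ 2) * s') := by
      rw [← key]; linarith
    have hs'pos : 0 < s' := by
      rcases h0.lt_or_eq with h | h
      · exact h
      · rw [← h, zero_mul] at hpos; exact absurd hpos (lt_irrefl 0)
    have hfac : 0 < 2 * (p * a + q * b) + (a ^ 2 + b ^ 2) * s' :=
      (pos_iff_pos_of_mul_pos hpos).1 hs'pos
    have hd : 0 ≤ a ^ 2 + b ^ 2 := by positivity
    have hfac' : 2 * (p * a + q * b) + (a ^ 2 + b ^ 2) * s' ≤
        2 * (p * a + q * b) + (a ^ 2 + b ^ 2) * s := by nlinarith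
    have hmono : s' * (2 * (p * a + q * b) + (a ^ 2 + b ^ 2) * s') ≤
        s * (2 * (p * a + q * b) + (a ^ 2 + b ^ 2) * s) :=
      mul_le_mul h1 hfac' hfac.le (hs'pos.le.trans h1)
    have := key s'; have := key s
    linarith

/-- Same bound for `s ≤ s' ≤ 0`. [folklore] -/
theorem quad_le_max' (p q a b s s' : ℝ) (h0 : s' ≤ 0) (h1 : s ≤ s') :
    (p + a * s') ^ 2 + (q + b * s') ^ 2 ≤
      max (p ^ 2 + q ^ 2) ((p + a * s) ^ 2 + (q + b * s) ^ 2) := by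
  have := quad_le_max p q (-a) (-b) (-s) (-s') (by linarith) (by linarith)
  have e1 : ∀ t : ℝ, (p + -a * -t) = p + a * t := fun t => by ring
  have e2 : ∀ t : ℝ, (q + -b * -t) = q + b * t := fun t => by ring
  simpa only [e1, e2] using this

end Quad

section Fields

variable {X : Type u} [TopologicalSpace X] [T2Space X] [CompactSpace X]
  [ChartedSpace (EuclideanSpace ℝ (Fin 4)) X] [IsManifold (𝓡 4) ∞ X]

omit [T2Space X] [CompactSpace X] [IsManifold (𝓡 4) ∞ X] in
/-- **Reading a derivative in a chart adapted to a function.**  If the `c`-th coordinate of a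
chart `Ξ` of the maximal atlas is the function `f` on the chart domain, then
`df_y(w) = (dΞ_y w)_c` at every point `y` of the domain. [folklore] -/
theorem mlineDeriv_eq_mfderiv_chart_apply {Ξ : OpenPartialHomeomorph X (EuclideanSpace ℝ (Fin 4))}
    (hΞ : Ξ ∈ IsManifold.maximalAtlas (𝓡 4) ∞ X) {f : X → ℝ} {c : Fin 4}
    (hf : ∀ y ∈ Ξ.source, Ξ y c = f y) {y : X} (hy : y ∈ Ξ.source)
    (w : TangentSpace (𝓡 4) y) :
    mlineDeriv (𝓡 4) f y w =
      EuclideanSpace.proj (𝕜 := ℝ) c (mfderiv (𝓡 4) (𝓡 4) Ξ y w) := by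
  have hΞd : HasMFDerivAt (𝓡 4) (𝓡 4) Ξ y (mfderiv (𝓡 4) (𝓡 4) Ξ y) :=
    ((contMDiffAt_of_mem_maximalAtlas hΞ hy).mdifferentiableAt (by simp)).hasMFDerivAt
  have hproj : HasMFDerivAt (𝓡 4) 𝓘(ℝ, ℝ) (fun q : EuclideanSpace ℝ (Fin 4) => q c) (Ξ y)
      (EuclideanSpace.proj (𝕜 := ℝ) c) := by
    rw [hasMFDerivAt_iff_hasFDerivAt]
    exact (EuclideanSpace.proj (𝕜 := ℝ) c).hasFDerivAt
  have hcomp := hproj.comp y hΞd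
  have hev : f =ᶠ[𝓝 y] (fun q : EuclideanSpace ℝ (Fin 4) => q c) ∘ Ξ := by
    filter_upwards [Ξ.open_source.mem_nhds hy] with z hz
    exact (hf z hz).symm
  have hfd : HasMFDerivAt (𝓡 4) 𝓘(ℝ, ℝ) f y
      ((EuclideanSpace.proj (𝕜 := ℝ) c).comp (mfderiv (𝓡 4) (𝓡 4) Ξ y)) :=
    hcomp.congr_of_eventuallyEq hev
  rw [mlineDeriv, hfd.mfderiv]
  rfl

omit [T2Space X] [CompactSpace X] in
/-- **A local vector field with prescribed derivatives of two coordinate functions.**  If `u`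
and `v` are the first two coordinates of a chart `Ξ` of the maximal atlas, then near every
point of the chart domain there is a smooth local vector field `s` with `du(s) = a` and
`dv(s) = b` identically (two local fields through `dΞ⁻¹e₀`, `dΞ⁻¹e₁`, and Cramer's rule for
the `2 × 2` system, which is the identity matrix at the centre). [folklore] -/
theorem exists_local_section_mlineDeriv_eq {u v : X → ℝ} (hu : ContMDiff (𝓡 4) 𝓘(ℝ, ℝ) ∞ u)
    (hv : ContMDiff (𝓡 4) 𝓘(ℝ, ℝ) ∞ v) {Ξ : OpenPartialHomeomorph X (EuclideanSpace ℝ (Fin 4))}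
    (hΞ : Ξ ∈ IsManifold.maximalAtlas (𝓡 4) ∞ X)
    (hΞu : ∀ y ∈ Ξ.source, Ξ y 0 = u y) (hΞv : ∀ y ∈ Ξ.source, Ξ y 1 = v y)
    {x₀ : X} (hx₀ : x₀ ∈ Ξ.source) (a b : ℝ) :
    ∃ O ∈ 𝓝 x₀, ∃ s : Π x : X, TangentSpace (𝓡 4) x,
      ContMDiffOn (𝓡 4) (𝓡 4).tangent ∞ (fun x => (⟨x, s x⟩ : TangentBundle (𝓡 4) X)) O ∧
      ∀ y ∈ O, mlineDeriv (𝓡 4) u y (s y) = a ∧ mlineDeriv (𝓡 4) v y (s y) = b := by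
  -- two tangent vectors at `x₀` dual to `(du, dv)`
  have hmd : Ξ.MDifferentiable (𝓡 4) (𝓡 4) :=
    ⟨(contMDiffOn_of_mem_maximalAtlas hΞ).mdifferentiableOn (by simp),
      (contMDiffOn_symm_of_mem_maximalAtlas hΞ).mdifferentiableOn (by simp)⟩
  have hsurj : Surjective (mfderiv (𝓡 4) (𝓡 4) Ξ x₀) := hmd.mfderiv_surjective hx₀
  obtain ⟨w₁, hw₁⟩ := hsurj (EuclideanSpace.single 0 1)
  obtain ⟨w₂, hw₂⟩ := hsurj (EuclideanSpace.single 1 1)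
  have hdu : ∀ (y) (hy : y ∈ Ξ.source) (w : TangentSpace (𝓡 4) y),
      mlineDeriv (𝓡 4) u y w = EuclideanSpace.proj (𝕜 := ℝ) (0 : Fin 4)
        (mfderiv (𝓡 4) (𝓡 4) Ξ y w) :=
    fun y hy w => mlineDeriv_eq_mfderiv_chart_apply hΞ hΞu hy w
  have hdv : ∀ (y) (hy : y ∈ Ξ.source) (w : TangentSpace (𝓡 4) y),
      mlineDeriv (𝓡 4) v y w = EuclideanSpace.proj (𝕜 := ℝ) (1 : Fin 4)
        (mfderiv (𝓡 4) (𝓡 4) Ξ y w) :=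
    fun y hy w => mlineDeriv_eq_mfderiv_chart_apply hΞ hΞv hy w
  have hw₁u : mlineDeriv (𝓡 4) u x₀ w₁ = 1 := by rw [hdu _ hx₀, hw₁]; simp
  have hw₁v : mlineDeriv (𝓡 4) v x₀ w₁ = 0 := by rw [hdv _ hx₀, hw₁]; simp
  have hw₂u : mlineDeriv (𝓡 4) u x₀ w₂ = 0 := by rw [hdu _ hx₀, hw₂]; simp
  have hw₂v : mlineDeriv (𝓡 4) v x₀ w₂ = 1 := by rw [hdv _ hx₀, hw₂]; simp
  -- local fields through them
  obtain ⟨O₁, s₁, hO₁, hx₀O₁, hs₁x₀, hs₁⟩ := exists_contMDiffOn_section_eq (I := 𝓡 4) x₀ w₁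
  obtain ⟨O₂, s₂, hO₂, hx₀O₂, hs₂x₀, hs₂⟩ := exists_contMDiffOn_section_eq (I := 𝓡 4) x₀ w₂
  set O := O₁ ∩ O₂ with hO
  have hOopen : IsOpen O := hO₁.inter hO₂
  have hx₀O : x₀ ∈ O := ⟨hx₀O₁, hx₀O₂⟩
  have hs₁O := hs₁.mono (inter_subset_left : O ⊆ O₁)
  have hs₂O := hs₂.mono (inter_subset_right : O ⊆ O₂)
  -- the matrix of the system and its determinant
  set m₁₁ : X → ℝ := fun y => mlineDeriv (𝓡 4) u y (s₁ y) with hm₁₁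
  set m₁₂ : X → ℝ := fun y => mlineDeriv (𝓡 4) u y (s₂ y) with hm₁₂
  set m₂₁ : X → ℝ := fun y => mlineDeriv (𝓡 4) v y (s₁ y) with hm₂₁
  set m₂₂ : X → ℝ := fun y => mlineDeriv (𝓡 4) v y (s₂ y) with hm₂₂
  have hm₁₁s : ContMDiffOn (𝓡 4) 𝓘(ℝ, ℝ) ∞ m₁₁ O := contMDiffOn_mlineDeriv_section hu hs₁O
  have hm₁₂s : ContMDiffOn (𝓡 4) 𝓘(ℝ, ℝ) ∞ m₁₂ O := contMDiffOn_mlineDeriv_section hu hs₂O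
  have hm₂₁s : ContMDiffOn (𝓡 4) 𝓘(ℝ, ℝ) ∞ m₂₁ O := contMDiffOn_mlineDeriv_section hv hs₁O
  have hm₂₂s : ContMDiffOn (𝓡 4) 𝓘(ℝ, ℝ) ∞ m₂₂ O := contMDiffOn_mlineDeriv_section hv hs₂O
  set det : X → ℝ := fun y => m₁₁ y * m₂₂ y - m₁₂ y * m₂₁ y with hdet
  have hdets : ContMDiffOn (𝓡 4) 𝓘(ℝ, ℝ) ∞ det O := (hm₁₁s.mul hm₂₂s).sub (hm₁₂s.mul hm₂₁s)
  have hdet₀ : det x₀ = 1 := by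
    simp only [hdet, hm₁₁, hm₁₂, hm₂₁, hm₂₂, hs₁x₀, hs₂x₀, hw₁u, hw₁v, hw₂u, hw₂v]; norm_num
  -- the neighbourhood where the determinant does not vanish
  set O' := O ∩ {y | det y ≠ 0} with hO'
  have hO'open : IsOpen O' := by
    rw [hO', show O ∩ {y | det y ≠ 0} = O ∩ det ⁻¹' {0}ᶜ from rfl]
    exact hdets.continuousOn.isOpen_inter_preimage hOopen isOpen_compl_singleton
  have hx₀O' : x₀ ∈ O' := ⟨hx₀O, by show det x₀ ≠ 0; rw [hdet₀]; exact one_ne_zero⟩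
  -- Cramer
  set c₁ : X → ℝ := fun y => (a * m₂₂ y - b * m₁₂ y) / det y with hc₁
  set c₂ : X → ℝ := fun y => (b * m₁₁ y - a * m₂₁ y) / det y with hc₂
  have hsub : O' ⊆ O := inter_subset_left
  have hc₁s : ContMDiffOn (𝓡 4) 𝓘(ℝ, ℝ) ∞ c₁ O' :=
    (((contMDiffOn_const.mul (hm₂₂s.mono hsub)).sub (contMDiffOn_const.mul (hm₁₂s.mono hsub))).div₀
      (hdets.mono hsub) fun y hy => hy.2)
  have hc₂s : ContMDiffOn (𝓡 4) 𝓘(ℝ, ℝ) ∞ c₂ O' :=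
    (((contMDiffOn_const.mul (hm₁₁s.mono hsub)).sub (contMDiffOn_const.mul (hm₂₁s.mono hsub))).div₀
      (hdets.mono hsub) fun y hy => hy.2)
  refine ⟨O', hO'open.mem_nhds hx₀O', fun y => c₁ y • s₁ y + c₂ y • s₂ y, ?_, fun y hy => ?_⟩
  · exact (hc₁s.smul_section (hs₁O.mono hsub)).add_section (hc₂s.smul_section (hs₂O.mono hsub))
  · have hdy : det y ≠ 0 := hy.2
    constructor
    · show mlineDeriv (𝓡 4) u y (c₁ y • s₁ y + c₂ y • s₂ y) = a
      rw [mlineDeriv_add, mlineDeriv_smul, mlineDeriv_smul]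
      change c₁ y * m₁₁ y + c₂ y * m₁₂ y = a
      simp only [hc₁, hc₂]
      field_simp
      simp only [hdet]; ring
    · show mlineDeriv (𝓡 4) v y (c₁ y • s₁ y + c₂ y • s₂ y) = b
      rw [mlineDeriv_add, mlineDeriv_smul, mlineDeriv_smul]
      change c₁ y * m₂₁ y + c₂ y * m₂₂ y = b
      simp only [hc₁, hc₂]
      field_simp
      simp only [hdet]; ring

/-- **A global vector field with prescribed derivatives of the two normal coordinates along a
closed set** (partition of unity: Mathlib's `exists_contMDiffSection_forall_mem_convex_of_local`
for the convex constraint sets `{w | y ∈ C → du(w) = a ∧ dv(w) = b}`, fed with the local fields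
of `exists_local_section_mlineDeriv_eq` at the points of `C` and the zero field off `C`).
[cite: MilnorHCobordism1965, proof of Lemma 3.2 (partition of unity)] -/
theorem exists_section_mlineDeriv_eq {u v : X → ℝ} (hu : ContMDiff (𝓡 4) 𝓘(ℝ, ℝ) ∞ u)
    (hv : ContMDiff (𝓡 4) 𝓘(ℝ, ℝ) ∞ v) {C : Set X} (hC : IsClosed C)
    (hchart : ∀ x ∈ C, ∃ Ξ : OpenPartialHomeomorph X (EuclideanSpace ℝ (Fin 4)),
      Ξ ∈ IsManifold.maximalAtlas (𝓡 4) ∞ X ∧ x ∈ Ξ.source ∧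
      ∀ y ∈ Ξ.source, Ξ y 0 = u y ∧ Ξ y 1 = v y) (a b : ℝ) :
    ∃ ξ : Cₛ^∞⟮𝓡 4; EuclideanSpace ℝ (Fin 4), (TangentSpace (𝓡 4) : X → Type _)⟯,
      ∀ y ∈ C, mlineDeriv (𝓡 4) u y (ξ y) = a ∧ mlineDeriv (𝓡 4) v y (ξ y) = b := by
  have hconv : ∀ y : X, Convex ℝ {w : TangentSpace (𝓡 4) y |
      y ∈ C → mlineDeriv (𝓡 4) u y w = a ∧ mlineDeriv (𝓡 4) v y w = b} := by
    intro y
    by_cases hy : y ∈ C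
    · intro w hw w' hw' p q _ _ hpq
      simp only [mem_setOf_eq, hy, forall_true_left] at hw hw' ⊢
      simp only [mlineDeriv_add, mlineDeriv_smul, hw.1, hw.2, hw'.1, hw'.2]
      exact ⟨by linear_combination a * hpq, by linear_combination b * hpq⟩
    · simp only [hy, IsEmpty.forall_iff, setOf_true]; exact convex_univ
  obtain ⟨ξ, hξ⟩ : ∃ ξ : Cₛ^∞⟮𝓡 4; EuclideanSpace ℝ (Fin 4), (TangentSpace (𝓡 4) : X → Type _)⟯,
      ∀ y, ξ y ∈ {w : TangentSpace (𝓡 4) y |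
        y ∈ C → mlineDeriv (𝓡 4) u y w = a ∧ mlineDeriv (𝓡 4) v y w = b} := by
    refine exists_contMDiffSection_forall_mem_convex_of_local (𝓡 4)
      (TangentSpace (𝓡 4) : X → Type _) _ hconv (fun x₀ => ?_)
    by_cases hx₀ : x₀ ∈ C
    · obtain ⟨Ξ, hΞ, hx₀Ξ, hΞuv⟩ := hchart x₀ hx₀
      obtain ⟨O, hO, s, hs, hsab⟩ := exists_local_section_mlineDeriv_eq hu hv hΞ
        (fun y hy => (hΞuv y hy).1) (fun y hy => (hΞuv y hy).2) hx₀Ξ a b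
      exact ⟨O, hO, s, hs, fun y hy _ => hsab y hy⟩
    · refine ⟨Cᶜ, hC.isOpen_compl.mem_nhds hx₀, fun _ => 0, ?_, fun y hy hyC => absurd hyC hy⟩
      exact (contMDiff_zeroSection ℝ (TangentSpace (𝓡 4) : X → Type _)).contMDiffOn
  exact ⟨ξ, fun y hy => hξ y hy⟩

end Fields

section Product

variable {X : Type u} [TopologicalSpace X] [T2Space X] [CompactSpace X]
  [ChartedSpace (EuclideanSpace ℝ (Fin 4)) X] [IsManifold (𝓡 4) ∞ X]

/-- **The flow of a normal field moves the two normal coordinates linearly** (consequence of the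
two-dimensional clock `clock_two`): if `ξ` is a smooth vector field on the closed `4`-manifold
`X` with `du(ξ) = a`, `dv(ξ) = b` on the open set `O ⊆ C` (`C` closed, `u² + v² < η` on `O`,
and every point of `C` with `u² + v² < η` in `O`), then from `y ∈ O` the flow stays in `O`
with `u = u y + a s`, `v = v y + b s` up to any time `s` whose *endpoint* values satisfy
`(u y + a s)² + (v y + b s)² < η` (the disc being convex, the whole segment of predicted values
lies in it). [folklore] -/
theorem flow_mem_and_apply_eq {u v : X → ℝ} (hu : ContMDiff (𝓡 4) 𝓘(ℝ, ℝ) ∞ u)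
    (hv : ContMDiff (𝓡 4) 𝓘(ℝ, ℝ) ∞ v)
    {ξ : Π x : X, TangentSpace (𝓡 4) x}
    (hξ : ContMDiff (𝓡 4) (𝓡 4).tangent ∞ fun x => (⟨x, ξ x⟩ : TangentBundle (𝓡 4) X))
    {C O : Set X} (hC : IsClosed C) (hO : IsOpen O) (hOC : O ⊆ C) {η a b : ℝ}
    (hOη : ∀ y ∈ O, u y ^ 2 + v y ^ 2 < η) (hCO : ∀ y ∈ C, u y ^ 2 + v y ^ 2 < η → y ∈ O)
    (ha : ∀ y ∈ O, mlineDeriv (𝓡 4) u y (ξ y) = a) (hb : ∀ y ∈ O, mlineDeriv (𝓡 4) v y (ξ y) = b)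
    {y : X} (hy : y ∈ O) {s : ℝ} (hs : (u y + a * s) ^ 2 + (v y + b * s) ^ 2 < η) :
    flow hξ y s ∈ O ∧ u (flow hξ y s) = u y + a * s ∧ v (flow hξ y s) = v y + b * s := by
  have hγ : Continuous (flow hξ y) := (isMIntegralCurve_flow hξ y).continuous
  have hg : ∀ t, HasDerivAt (u ∘ flow hξ y)
      (mlineDeriv (𝓡 4) u (flow hξ y t) (ξ (flow hξ y t))) t :=
    hasDerivAt_comp_integralCurve hu (isMIntegralCurve_flow hξ y)
  have hh : ∀ t, HasDerivAt (v ∘ flow hξ y)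
      (mlineDeriv (𝓡 4) v (flow hξ y t) (ξ (flow hξ y t))) t :=
    hasDerivAt_comp_integralCurve hv (isMIntegralCurve_flow hξ y)
  have h0 : flow hξ y 0 ∈ O := by rw [flow_zero]; exact hy
  have hu0 : u (flow hξ y 0) = u y := by rw [flow_zero]
  have hv0 : v (flow hξ y 0) = v y := by rw [flow_zero]
  rcases le_total 0 s with hs0 | hs0
  · have key := clock_two hγ hu.continuous hv.continuous hg hh hC hO hOC hCO
      (fun t ht => ha _ ht) (fun t ht => hb _ ht) (t₀ := 0) (T := s) h0 (fun s' hs' => by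
        rw [hu0, hv0]
        exact (quad_le_max (u y) (v y) a b s s' hs'.1 hs'.2).trans_lt
          (max_lt (hOη y hy) hs))
    obtain ⟨h1, h2, h3⟩ := key s ⟨hs0, le_rfl⟩
    rw [zero_add] at h1 h2 h3
    rw [hu0] at h2; rw [hv0] at h3
    exact ⟨h1, h2, h3⟩
  · have key := clock_two_neg hγ hu.continuous hv.continuous hg hh hC hO hOC hCO
      (fun t ht => ha _ ht) (fun t ht => hb _ ht) (t₀ := 0) (T := -s) h0 (fun s' hs' => by
        rw [hu0, hv0]
        exact (quad_le_max' (u y) (v y) a b s s' hs'.2 (by linarith [hs'.1])).trans_lt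
          (max_lt (hOη y hy) hs))
    obtain ⟨h1, h2, h3⟩ := key s ⟨by linarith, hs0⟩
    rw [zero_add] at h1 h2 h3
    rw [hu0] at h2; rw [hv0] at h3
    exact ⟨h1, h2, h3⟩


/-- `stratumProj q` written out. [folklore] -/
theorem stratumProj_eq (q : EuclideanSpace ℝ (Fin 4)) :
    stratumProj q = !₂[0, 0, q 2, q 3] := rfl

/-- **Product structure and corner-slice charts along the corner locus.**  Let `u, v` be two
smooth functions on the closed `4`-manifold `X` and `U` an open set in which the subset
`S ⊆ X` is the quadrant `{u ≥ 0, v ≥ 0}` and the compact set `K ⊆ U` is the corner stratum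
`{u = v = 0}`, and assume that at every point of `K` the pair `(u, v)` is completed to a chart
of the maximal atlas.  Then there are an open neighbourhood `O ⊆ U` of `K` and a smooth
retraction `π` of `O` onto `K` (the composite of the flows of two vector fields `ξ₁`, `ξ₂`
with `du(ξ₁) = 1, dv(ξ₁) = 0`, `du(ξ₂) = 0, dv(ξ₂) = 1` near `K`, for the times `-u` and
`-v`: Milnor's drop onto a level, twice) such that every point of `K` lies in the domain of a
**corner-slice chart** `Literature.Topology.FourManifolds.CornerSliceChart S K u v π`
(the chart `y ↦ (u y, v y, Ξ(π y)₂, Ξ(π y)₃)`, whose inverse is the two-parameter flow-out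
`(a, b, z) ↦ φ¹_a φ²_b z` of the corner stratum, by the group law of the flows and the
two-dimensional clock). [cite: Milnor1963, proof of Thm. 3.1; Douady1961, §4] -/
theorem exists_cornerSliceChart_of_normalCoordinates {u v : X → ℝ}
    (hu : ContMDiff (𝓡 4) 𝓘(ℝ, ℝ) ∞ u) (hv : ContMDiff (𝓡 4) 𝓘(ℝ, ℝ) ∞ v)
    {U S K : Set X} (hUo : IsOpen U) (hKc : IsCompact K) (hKU : K ⊆ U)
    (hS : ∀ y ∈ U, y ∈ S ↔ 0 ≤ u y ∧ 0 ≤ v y) (hK : ∀ y ∈ U, y ∈ K ↔ u y = 0 ∧ v y = 0)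
    (hchart : ∀ x ∈ K, ∃ Ξ : OpenPartialHomeomorph X (EuclideanSpace ℝ (Fin 4)),
      Ξ ∈ IsManifold.maximalAtlas (𝓡 4) ∞ X ∧ x ∈ Ξ.source ∧
      ∀ y ∈ Ξ.source, Ξ y 0 = u y ∧ Ξ y 1 = v y) :
    ∃ (O : Set X) (ρ : X → X), IsOpen O ∧ K ⊆ O ∧ O ⊆ U ∧ ContMDiff (𝓡 4) (𝓡 4) ∞ ρ ∧
      (∀ y ∈ O, ρ y ∈ K) ∧ (∀ y ∈ U, u y = 0 → v y = 0 → ρ y = y) ∧ MapsTo ρ O O ∧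
      ∀ x ∈ K, ∃ c : CornerSliceChart S K u v ρ, x ∈ c.Θ.source ∧ c.Θ.source ⊆ O := by
  haveI : LocallyCompactSpace X := ChartedSpace.locallyCompactSpace (EuclideanSpace ℝ (Fin 4)) X
  -- ### the neighbourhood `W` of `K` carrying adapted charts, and a compact `C` in between
  choose Ξx hΞx using hchart
  set W : Set X := U ∩ ⋃ x : K, (Ξx x.1 x.2).source with hW
  have hWo : IsOpen W := hUo.inter (isOpen_iUnion fun x => (Ξx x.1 x.2).open_source)
  have hKW : K ⊆ W := fun x hx => ⟨hKU hx, mem_iUnion.2 ⟨⟨x, hx⟩, (hΞx x hx).2.1⟩⟩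
  obtain ⟨C, hCc, hKC, hCW⟩ := exists_compact_between hKc hWo hKW
  have hCcl : IsClosed C := hCc.isClosed
  have hCU : C ⊆ U := fun y hy => (hCW hy).1
  have hchartC : ∀ x ∈ C, ∃ Ξ : OpenPartialHomeomorph X (EuclideanSpace ℝ (Fin 4)),
      Ξ ∈ IsManifold.maximalAtlas (𝓡 4) ∞ X ∧ x ∈ Ξ.source ∧
      ∀ y ∈ Ξ.source, Ξ y 0 = u y ∧ Ξ y 1 = v y := by
    intro x hx
    obtain ⟨-, hx2⟩ := hCW hx
    obtain ⟨z, hz⟩ := mem_iUnion.1 hx2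
    exact ⟨Ξx z.1 z.2, (hΞx z.1 z.2).1, hz, (hΞx z.1 z.2).2.2⟩
  -- ### the two normal fields
  obtain ⟨ξ₁, hξ₁⟩ := exists_section_mlineDeriv_eq hu hv hCcl hchartC 1 0
  obtain ⟨ξ₂, hξ₂⟩ := exists_section_mlineDeriv_eq hu hv hCcl hchartC 0 1
  have hξ₁s : ContMDiff (𝓡 4) (𝓡 4).tangent ∞
      fun x => (⟨x, ξ₁ x⟩ : TangentBundle (𝓡 4) X) := ξ₁.contMDiff
  have hξ₂s : ContMDiff (𝓡 4) (𝓡 4).tangent ∞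
      fun x => (⟨x, ξ₂ x⟩ : TangentBundle (𝓡 4) X) := ξ₂.contMDiff
  -- ### the radius `η` and the open set `O`
  obtain ⟨η, hη, hηC⟩ : ∃ η : ℝ, 0 < η ∧ ∀ y ∈ C, u y ^ 2 + v y ^ 2 < η → y ∈ interior C := by
    set B : Set X := C \ interior C with hB
    have hBc : IsCompact B := hCc.diff isOpen_interior
    rcases B.eq_empty_or_nonempty with hBe | hBne
    · refine ⟨1, one_pos, fun y hy _ => ?_⟩
      by_contra h'
      have : y ∈ B := ⟨hy, h'⟩
      rw [hBe] at this; exact this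
    · have hcont : ContinuousOn (fun y => u y ^ 2 + v y ^ 2) B :=
        ((hu.continuous.pow 2).add (hv.continuous.pow 2)).continuousOn
      obtain ⟨y₀, hy₀B, hy₀⟩ := hBc.exists_isMinOn hBne hcont
      have hpos : 0 < u y₀ ^ 2 + v y₀ ^ 2 := by
        by_contra h'
        push Not at h'
        have hu0 : u y₀ = 0 := by nlinarith [sq_nonneg (u y₀), sq_nonneg (v y₀)]
        have hv0 : v y₀ = 0 := by nlinarith [sq_nonneg (u y₀), sq_nonneg (v y₀)]
        have hyK : y₀ ∈ K := (hK y₀ (hCU hy₀B.1)).2 ⟨hu0, hv0⟩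
        exact hy₀B.2 (hKC hyK)
      refine ⟨u y₀ ^ 2 + v y₀ ^ 2, hpos, fun y hy hlt => ?_⟩
      by_contra h'
      have := hy₀ (show y ∈ B from ⟨hy, h'⟩)
      rw [mem_setOf_eq] at this
      exact absurd hlt (not_lt.2 this)
  set O : Set X := interior C ∩ {y | u y ^ 2 + v y ^ 2 < η} with hO
  have hOo : IsOpen O :=
    isOpen_interior.inter (isOpen_lt ((hu.continuous.pow 2).add (hv.continuous.pow 2))
      continuous_const)
  have hOC : O ⊆ C := fun y hy => interior_subset hy.1
  have hOU : O ⊆ U := fun y hy => hCU (hOC hy)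
  have hKO : K ⊆ O := fun y hy => by
    obtain ⟨hu0, hv0⟩ := (hK y (hKU hy)).1 hy
    exact ⟨hKC hy, by show u y ^ 2 + v y ^ 2 < η; rw [hu0, hv0]; simpa using hη⟩
  have hOη : ∀ y ∈ O, u y ^ 2 + v y ^ 2 < η := fun y hy => hy.2
  have hCO : ∀ y ∈ C, u y ^ 2 + v y ^ 2 < η → y ∈ O := fun y hy hlt => ⟨hηC y hy hlt, hlt⟩
  -- ### the flows and the clock
  have h1 : ∀ y ∈ O, ∀ s : ℝ, (u y + s) ^ 2 + v y ^ 2 < η →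
      flow hξ₁s y s ∈ O ∧ u (flow hξ₁s y s) = u y + s ∧ v (flow hξ₁s y s) = v y := by
    intro y hy s hs
    have := flow_mem_and_apply_eq hu hv hξ₁s hCcl hOo hOC (η := η) (a := 1) (b := 0) hOη hCO
      (fun z hz => (hξ₁ z (hOC hz)).1) (fun z hz => (hξ₁ z (hOC hz)).2) hy (s := s)
      (by simpa using hs)
    simpa using this
  have h2 : ∀ y ∈ O, ∀ s : ℝ, u y ^ 2 + (v y + s) ^ 2 < η →
      flow hξ₂s y s ∈ O ∧ u (flow hξ₂s y s) = u y ∧ v (flow hξ₂s y s) = v y + s := by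
    intro y hy s hs
    have := flow_mem_and_apply_eq hu hv hξ₂s hCcl hOo hOC (η := η) (a := 0) (b := 1) hOη hCO
      (fun z hz => (hξ₂ z (hOC hz)).1) (fun z hz => (hξ₂ z (hOC hz)).2) hy (s := s)
      (by simpa using hs)
    simpa using this
  -- ### the retraction `ρ` and the flow-out `Ψ`
  set ρ : X → X := fun y => flow hξ₂s (flow hξ₁s y (-u y)) (-v y) with hρ
  have hflow₁ : ContMDiff (𝓘(ℝ, ℝ).prod (𝓡 4)) (𝓡 4) ∞ fun p : ℝ × X => flow hξ₁s p.2 p.1 :=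
    contMDiff_flow hξ₁s
  have hflow₂ : ContMDiff (𝓘(ℝ, ℝ).prod (𝓡 4)) (𝓡 4) ∞ fun p : ℝ × X => flow hξ₂s p.2 p.1 :=
    contMDiff_flow hξ₂s
  have hρs : ContMDiff (𝓡 4) (𝓡 4) ∞ ρ := by
    have hA : ContMDiff (𝓡 4) (𝓡 4) ∞ fun y => flow hξ₁s y (-u y) :=
      hflow₁.comp (hu.neg.prodMk contMDiff_id)
    exact hflow₂.comp (hv.neg.prodMk hA)
  have hρO : ∀ y ∈ O, ρ y ∈ O ∧ u (ρ y) = 0 ∧ v (ρ y) = 0 := by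
    intro y hy
    obtain ⟨hy₁, hu₁, hv₁⟩ := h1 y hy (-u y) (by
      have := hOη y hy; nlinarith [sq_nonneg (u y)])
    obtain ⟨hy₂, hu₂, hv₂⟩ := h2 _ hy₁ (-v y) (by
      rw [hu₁, hv₁]; have := hOη y hy; nlinarith [sq_nonneg (u y), sq_nonneg (v y)])
    refine ⟨hy₂, ?_, ?_⟩
    · rw [hu₂, hu₁]; ring
    · rw [hv₂, hv₁]; ring
  have hρK : ∀ y ∈ O, ρ y ∈ K := fun y hy =>
    (hK _ (hOU (hρO y hy).1)).2 ⟨(hρO y hy).2.1, (hρO y hy).2.2⟩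
  have hρfix : ∀ y : X, u y = 0 → v y = 0 → ρ y = y := fun y hu0 hv0 => by
    simp only [hρ, hu0, hv0, neg_zero, flow_zero]
  have hρρ : ∀ y ∈ O, ρ (ρ y) = ρ y := fun y hy => hρfix _ (hρO y hy).2.1 (hρO y hy).2.2
  -- the flow-out of the stratum and its relation to `ρ`
  have hΨρ : ∀ y : X, flow hξ₁s (flow hξ₂s (ρ y) (v y)) (u y) = y := by
    intro y
    simp only [hρ]
    rw [← flow_add, neg_add_cancel, flow_zero, ← flow_add, neg_add_cancel, flow_zero]
  have hρΨ : ∀ z ∈ O, u z = 0 → v z = 0 → ∀ a b : ℝ, a ^ 2 + b ^ 2 < η →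
      flow hξ₁s (flow hξ₂s z b) a ∈ O ∧ u (flow hξ₁s (flow hξ₂s z b) a) = a ∧
      v (flow hξ₁s (flow hξ₂s z b) a) = b ∧ ρ (flow hξ₁s (flow hξ₂s z b) a) = z := by
    intro z hz hu0 hv0 a b hab
    obtain ⟨hz₂, hu₂, hv₂⟩ := h2 z hz b (by rw [hu0, hv0]; nlinarith [sq_nonneg a])
    obtain ⟨hz₁, hu₁, hv₁⟩ := h1 _ hz₂ a (by rw [hu₂, hv₂, hu0, hv0]; nlinarith)
    refine ⟨hz₁, by rw [hu₁, hu₂, hu0, zero_add], by rw [hv₁, hv₂, hv0, zero_add], ?_⟩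
    simp only [hρ]
    rw [hu₁, hu₂, hu0, zero_add, hv₁, hv₂, hv0, zero_add, ← flow_add, add_neg_cancel,
      flow_zero, ← flow_add, add_neg_cancel, flow_zero]
  refine ⟨O, ρ, hOo, hKO, hOU, hρs, hρK, fun y _ hu0 hv0 => hρfix y hu0 hv0,
    fun y hy => (hρO y hy).1, fun x hx => ?_⟩
  -- ### the corner-slice chart at `x ∈ K`
  set Ξ := Ξx x hx with hΞdef
  have hΞ : Ξ ∈ IsManifold.maximalAtlas (𝓡 4) ∞ X := (hΞx x hx).1
  have hxΞ : x ∈ Ξ.source := (hΞx x hx).2.1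
  have hΞuv : ∀ y ∈ Ξ.source, Ξ y 0 = u y ∧ Ξ y 1 = v y := (hΞx x hx).2.2
  set e0 : EuclideanSpace ℝ (Fin 4) := EuclideanSpace.single 0 1 with he0
  set e1 : EuclideanSpace ℝ (Fin 4) := EuclideanSpace.single 1 1 with he1
  set e2 : EuclideanSpace ℝ (Fin 4) := EuclideanSpace.single 2 1 with he2
  set e3 : EuclideanSpace ℝ (Fin 4) := EuclideanSpace.single 3 1 with he3
  set Θf : X → EuclideanSpace ℝ (Fin 4) := fun y =>
    (u y) • e0 + (v y) • e1 + (Ξ (ρ y) 2) • e2 + (Ξ (ρ y) 3) • e3 with hΘf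
  set Θi : EuclideanSpace ℝ (Fin 4) → X := fun q =>
    flow hξ₁s (flow hξ₂s (Ξ.symm (stratumProj q)) (q 1)) (q 0) with hΘi
  have hΘf0 : ∀ y, Θf y 0 = u y := fun y => by simp [hΘf, he0, he1, he2, he3]
  have hΘf1 : ∀ y, Θf y 1 = v y := fun y => by simp [hΘf, he0, he1, he2, he3]
  have hΘf2 : ∀ y, Θf y 2 = Ξ (ρ y) 2 := fun y => by simp [hΘf, he0, he1, he2, he3]
  have hΘf3 : ∀ y, Θf y 3 = Ξ (ρ y) 3 := fun y => by simp [hΘf, he0, he1, he2, he3]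
  set Src : Set X := O ∩ ρ ⁻¹' Ξ.source with hSrc
  set T₁ : Set (EuclideanSpace ℝ (Fin 4)) := stratumProj ⁻¹' Ξ.target with hT₁
  set Tgt : Set (EuclideanSpace ℝ (Fin 4)) :=
    {q | q 0 ^ 2 + q 1 ^ 2 < η} ∩ (T₁ ∩ (fun q => Ξ.symm (stratumProj q)) ⁻¹' O) with hTgt
  have hsPc : Continuous (stratumProj) := contDiff_stratumProj.continuous
  have hSrco : IsOpen Src := hOo.inter (Ξ.open_source.preimage hρs.continuous)
  have hT₁o : IsOpen T₁ := Ξ.open_target.preimage hsPc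
  have hzc : ContinuousOn (fun q => Ξ.symm (stratumProj q)) T₁ :=
    Ξ.continuousOn_symm.comp hsPc.continuousOn fun q hq => hq
  have hTgto : IsOpen Tgt := by
    refine (isOpen_lt ?_ continuous_const).inter (hzc.isOpen_inter_preimage hT₁o hOo)
    exact ((EuclideanSpace.proj (0 : Fin 4)).continuous.pow 2).add
      ((EuclideanSpace.proj (1 : Fin 4)).continuous.pow 2)
  -- `stratumProj ∘ Θf = Ξ ∘ ρ` on the source
  have hsPΘ : ∀ y ∈ Src, stratumProj (Θf y) = Ξ (ρ y) := by
    intro y hy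
    obtain ⟨hu0, hv0⟩ := (hρO y hy.1).2
    obtain ⟨hΞ0, hΞ1⟩ := hΞuv (ρ y) hy.2
    ext i
    fin_cases i
    · show stratumProj (Θf y) 0 = Ξ (ρ y) 0
      rw [stratumProj_apply_zero, hΞ0, hu0]
    · show stratumProj (Θf y) 1 = Ξ (ρ y) 1
      rw [stratumProj_apply_one, hΞ1, hv0]
    · show stratumProj (Θf y) 2 = Ξ (ρ y) 2
      rw [stratumProj_apply_two, hΘf2]
    · show stratumProj (Θf y) 3 = Ξ (ρ y) 3
      rw [stratumProj_apply_three, hΘf3]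
  -- the stratum point attached to a target point
  have hz : ∀ q ∈ Tgt, Ξ.symm (stratumProj q) ∈ Ξ.source ∧ Ξ.symm (stratumProj q) ∈ O ∧
      u (Ξ.symm (stratumProj q)) = 0 ∧ v (Ξ.symm (stratumProj q)) = 0 := by
    rintro q ⟨-, hq2, hq3⟩
    have hsrc : Ξ.symm (stratumProj q) ∈ Ξ.source := Ξ.map_target hq2
    obtain ⟨hΞ0, hΞ1⟩ := hΞuv _ hsrc
    rw [Ξ.right_inv hq2] at hΞ0 hΞ1
    exact ⟨hsrc, hq3, by rw [← hΞ0, stratumProj_apply_zero],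
      by rw [← hΞ1, stratumProj_apply_one]⟩
  have hmapsto : MapsTo Θf Src Tgt := by
    intro y hy
    refine ⟨?_, ?_, ?_⟩
    · show Θf y 0 ^ 2 + Θf y 1 ^ 2 < η
      rw [hΘf0, hΘf1]; exact hOη y hy.1
    · show stratumProj (Θf y) ∈ Ξ.target
      rw [hsPΘ y hy]; exact Ξ.map_source hy.2
    · show Ξ.symm (stratumProj (Θf y)) ∈ O
      rw [hsPΘ y hy, Ξ.left_inv hy.2]; exact (hρO y hy.1).1
  have hmapsto' : MapsTo Θi Tgt Src := by
    intro q hq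
    obtain ⟨hzs, hzO, hzu, hzv⟩ := hz q hq
    obtain ⟨h1', -, -, h4'⟩ := hρΨ _ hzO hzu hzv (q 0) (q 1) hq.1
    exact ⟨h1', by show ρ (Θi q) ∈ Ξ.source; rw [hΘi]; dsimp only; rw [h4']; exact hzs⟩
  have hleft : ∀ y ∈ Src, Θi (Θf y) = y := by
    intro y hy
    simp only [hΘi]
    rw [hsPΘ y hy, Ξ.left_inv hy.2, hΘf0, hΘf1]
    exact hΨρ y
  have hright : ∀ q ∈ Tgt, Θf (Θi q) = q := by
    intro q hq
    obtain ⟨hzs, hzO, hzu, hzv⟩ := hz q hq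
    obtain ⟨-, h2', h3', h4'⟩ := hρΨ _ hzO hzu hzv (q 0) (q 1) hq.1
    have hΞz : Ξ (Ξ.symm (stratumProj q)) = stratumProj q := Ξ.right_inv hq.2.1
    ext i
    fin_cases i
    · show Θf (Θi q) 0 = q 0
      rw [hΘf0]; exact h2'
    · show Θf (Θi q) 1 = q 1
      rw [hΘf1]; exact h3'
    · show Θf (Θi q) 2 = q 2
      rw [hΘf2]
      change Ξ (ρ (flow hξ₁s (flow hξ₂s (Ξ.symm (stratumProj q)) (q 1)) (q 0))) 2 = q 2
      rw [h4', hΞz, stratumProj_apply_two]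
    · show Θf (Θi q) 3 = q 3
      rw [hΘf3]
      change Ξ (ρ (flow hξ₁s (flow hξ₂s (Ξ.symm (stratumProj q)) (q 1)) (q 0))) 3 = q 3
      rw [h4', hΞz, stratumProj_apply_three]
  -- smoothness of the two maps
  have hproj : ∀ i : Fin 4, ContMDiff 𝓘(ℝ, EuclideanSpace ℝ (Fin 4)) 𝓘(ℝ, ℝ) ∞
      fun q : EuclideanSpace ℝ (Fin 4) => q i := fun i => by
    rw [contMDiff_iff_contDiff]; exact contDiff_piLp_apply (p := 2) (i := i)
  have hΘfs : ContMDiffOn (𝓡 4) 𝓘(ℝ, EuclideanSpace ℝ (Fin 4)) ∞ Θf Src := by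
    have hΞρ : ContMDiffOn (𝓡 4) (𝓡 4) ∞ (fun y => Ξ (ρ y)) Src :=
      (contMDiffOn_of_mem_maximalAtlas hΞ).comp hρs.contMDiffOn fun y hy => hy.2
    have hc2 : ContMDiffOn (𝓡 4) 𝓘(ℝ, ℝ) ∞ (fun y => Ξ (ρ y) 2) Src :=
      (hproj 2).comp_contMDiffOn hΞρ
    have hc3 : ContMDiffOn (𝓡 4) 𝓘(ℝ, ℝ) ∞ (fun y => Ξ (ρ y) 3) Src :=
      (hproj 3).comp_contMDiffOn hΞρ
    exact (((hu.contMDiffOn.smul contMDiffOn_const).add (hv.contMDiffOn.smul contMDiffOn_const)).add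
      (hc2.smul contMDiffOn_const)).add (hc3.smul contMDiffOn_const)
  have hsPs : ContMDiff 𝓘(ℝ, EuclideanSpace ℝ (Fin 4)) 𝓘(ℝ, EuclideanSpace ℝ (Fin 4)) ∞
      stratumProj := contMDiff_iff_contDiff.2 contDiff_stratumProj
  have hΘis : ContMDiffOn 𝓘(ℝ, EuclideanSpace ℝ (Fin 4)) (𝓡 4) ∞ Θi Tgt := by
    have hzs' : ContMDiffOn 𝓘(ℝ, EuclideanSpace ℝ (Fin 4)) (𝓡 4) ∞
        (fun q => Ξ.symm (stratumProj q)) T₁ :=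
      (contMDiffOn_symm_of_mem_maximalAtlas hΞ).comp hsPs.contMDiffOn fun q hq => hq
    have hA : ContMDiffOn 𝓘(ℝ, EuclideanSpace ℝ (Fin 4)) (𝓡 4) ∞
        (fun q => flow hξ₂s (Ξ.symm (stratumProj q)) (q 1)) T₁ :=
      hflow₂.comp_contMDiffOn ((hproj 1).contMDiffOn.prodMk hzs')
    have hB : ContMDiffOn 𝓘(ℝ, EuclideanSpace ℝ (Fin 4)) (𝓡 4) ∞ Θi T₁ :=
      hflow₁.comp_contMDiffOn ((hproj 0).contMDiffOn.prodMk hA)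
    exact hB.mono fun q hq => hq.2.1
  -- the open partial homeomorphism
  let Θ : OpenPartialHomeomorph X (EuclideanSpace ℝ (Fin 4)) :=
    { toFun := Θf
      invFun := Θi
      source := Src
      target := Tgt
      map_source' := fun y hy => hmapsto hy
      map_target' := fun q hq => hmapsto' hq
      left_inv' := fun y hy => hleft y hy
      right_inv' := fun q hq => hright q hq
      open_source := hSrco
      open_target := hTgto
      continuousOn_toFun := hΘfs.continuousOn
      continuousOn_invFun := hΘis.continuousOn }
  have hΘcoe : (Θ : X → EuclideanSpace ℝ (Fin 4)) = Θf := rfl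
  have hΘsymm : (Θ.symm : EuclideanSpace ℝ (Fin 4) → X) = Θi := rfl
  have hΘsrc : Θ.source = Src := rfl
  have hΘtgt : Θ.target = Tgt := rfl
  refine ⟨⟨Θ, ?_, ?_, fun q hq => ?_, fun q _ => ?_, fun q _ => ?_, fun q hq => ?_,
    fun q hq => ?_, fun q hq => ?_⟩, ?_, ?_⟩
  · rw [hΘsrc, hΘcoe]; exact hΘfs
  · rw [hΘtgt, hΘsymm]; exact hΘis
  · -- `S` is the quadrant
    rw [hΘsrc] at hq
    rw [hS q (hOU hq.1), hΘcoe]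
    show 0 ≤ u q ∧ 0 ≤ v q ↔ 0 ≤ Θf q 0 ∧ 0 ≤ Θf q 1
    rw [hΘf0, hΘf1]
  · rw [hΘcoe]; exact hΘf0 q
  · rw [hΘcoe]; exact hΘf1 q
  · -- `ρ` preserves the source
    rw [hΘsrc] at hq ⊢
    exact ⟨(hρO q hq.1).1, by show ρ (ρ q) ∈ Ξ.source; rw [hρρ q hq.1]; exact hq.2⟩
  · -- `Θ (ρ q) = stratumProj (Θ q)`
    rw [hΘsrc] at hq
    rw [hΘcoe]
    obtain ⟨hu0, hv0⟩ := (hρO q hq.1).2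
    ext i
    fin_cases i
    · show Θf (ρ q) 0 = stratumProj (Θf q) 0
      rw [hΘf0, hu0, stratumProj_apply_zero]
    · show Θf (ρ q) 1 = stratumProj (Θf q) 1
      rw [hΘf1, hv0, stratumProj_apply_one]
    · show Θf (ρ q) 2 = stratumProj (Θf q) 2
      rw [hΘf2, hρρ q hq.1, stratumProj_apply_two, hΘf2]
    · show Θf (ρ q) 3 = stratumProj (Θf q) 3
      rw [hΘf3, hρρ q hq.1, stratumProj_apply_three, hΘf3]
  · -- `K` is the corner stratum
    rw [hΘsrc] at hq
    exact hK q (hOU hq.1)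
  · -- `x` is in the source
    show x ∈ Src
    obtain ⟨hu0, hv0⟩ := (hK x (hKU hx)).1 hx
    exact ⟨hKO hx, by show ρ x ∈ Ξ.source; rw [hρfix x hu0 hv0]; exact hxΞ⟩
  · show Src ⊆ O
    exact inter_subset_left

end Product


/-! ### Corner-slice charts of a sector along the central surface -/

section Trisection

variable {X : Type u} [TopologicalSpace X] [T2Space X] [CompactSpace X]
  [ChartedSpace (EuclideanSpace ℝ (Fin 4)) X] [IsManifold (𝓡 4) ∞ X]
  {g : ℕ} {k : Fin 3 → ℕ} {S : Fin 3 → Set X}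

/-- **Corner-slice charts of a sector of a Gay–Kirby trisection along the whole central
surface.**  For a trisection with corners `S` of a closed smooth `4`-manifold `X`, a sector
`S i` and a second sector `S j`: global normal coordinates `u, v` in which the three sectors
are the three linear sectors of the plane near `F = ⋂ l, S l`
(`IsGKTrisection.exists_normalCoordinates`), a smooth retraction `ρ` of a neighbourhood `O`
of `F` onto `F`, and at every point of `F` a corner-slice chart of `S i` relative to
`(F, u, v, ρ)` with domain inside `O` (`exists_cornerSliceChart_of_normalCoordinates`).
[cite: GayKirby2016, Def. 1 and Fig. 1; Douady1961, §4] -/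
theorem IsGKTrisection.exists_cornerSliceCharts (h : IsGKTrisection X g k S) {i j : Fin 3}
    (hji : j ≠ i) :
    ∃ (u v : X → ℝ) (U O : Set X) (ρ : X → X) (l : Fin 3), l ≠ i ∧ l ≠ j ∧ IsOpen U ∧
      IsOpen O ∧ (⋂ m, S m) ⊆ O ∧ O ⊆ U ∧
      ContMDiff (𝓡 4) 𝓘(ℝ, ℝ) ∞ u ∧ ContMDiff (𝓡 4) 𝓘(ℝ, ℝ) ∞ v ∧
      ContMDiff (𝓡 4) (𝓡 4) ∞ ρ ∧
      (∀ y ∈ U, y ∈ S i ↔ 0 ≤ u y ∧ 0 ≤ v y) ∧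
      (∀ y ∈ U, y ∈ S j ↔ u y ≤ 0 ∧ u y ≤ v y) ∧
      (∀ y ∈ U, y ∈ S l ↔ v y ≤ 0 ∧ v y ≤ u y) ∧
      (∀ y ∈ U, y ∈ (⋂ m, S m) ↔ u y = 0 ∧ v y = 0) ∧
      (∀ y ∈ O, ρ y ∈ ⋂ m, S m) ∧ (∀ y ∈ U, u y = 0 → v y = 0 → ρ y = y) ∧ MapsTo ρ O O ∧
      ∀ x ∈ ⋂ m, S m, ∃ c : CornerSliceChart (S i) (⋂ m, S m) u v ρ,
        x ∈ c.Θ.source ∧ c.Θ.source ⊆ O := by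
  obtain ⟨u, v, U, l, hli, hlj, hUo, hFU, hu, hv, hSi, hSj, hSl, hF, hchart⟩ :=
    h.exists_normalCoordinates hji
  have hchart' : ∀ x ∈ ⋂ m, S m, ∃ Ξ : OpenPartialHomeomorph X (EuclideanSpace ℝ (Fin 4)),
      Ξ ∈ IsManifold.maximalAtlas (𝓡 4) ∞ X ∧ x ∈ Ξ.source ∧
      ∀ y ∈ Ξ.source, Ξ y 0 = u y ∧ Ξ y 1 = v y := fun x hx => by
    obtain ⟨Ξ, hΞ, hxΞ, hΞuv⟩ := hchart x hx
    exact ⟨Ξ, hΞ, hxΞ, hΞuv⟩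
  obtain ⟨O, ρ, hOo, hFO, hOU, hρ, hρF, hρfix, hρO, hc⟩ :=
    exists_cornerSliceChart_of_normalCoordinates hu hv hUo h.isCompact_iInter hFU hSi hF hchart'
  exact ⟨u, v, U, O, ρ, l, hli, hlj, hUo, hOo, hFO, hOU, hu, hv, hρ, hSi, hSj, hSl, hF, hρF,
    hρfix, hρO, hc⟩

end Trisection

end Literature.Topology.FourManifolds
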